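import Summits.CriticalPhenomena.PercolationContinuityZ3.Theorems.PercNearOneGluingNoHeavyQuantRootReductionSizeBiased
import HarnessLib

/-!
# QUANT lane R8, FAR on general trees — the root row for forests of SUB-UNIT-MEAN structures (unconditional): if every root
# structure has expected count `≤ 1` (and the floor `x` satisfies `x·M k ≤ E N_k`, automatic when each of the `M k` relays has
# marginal `≥ x`), then `EN > 2j ⟹ P(N ≥ j+1) ≥ x`

builds on p205010 (kernel theorem, internal audit signed; external expert review pending)

Support file (`--supports stmt-CriticalPhenomena-4575`), QUANT lane typer seat prim-quant-stmt (gen 17), rung R8 of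
`run/shared/lean/prim/quant/LADDER.md`.  Theorems only, no sorries, standard axioms.  The heavy + sure row
`Quant.RootDec.rtail_ge_of_heavyDec` (`…QuantRootReduction`, p251015) fed with the size-biased decomposition
`Quant.RootDec.twoPoint_sizeBiased` (`…QuantRootReductionSizeBiased`, p251965; lead g15 README V186 (4)): a structure law of mean
`m ≤ 1` on `{0..M}` is the mixture `Σ_r (r ν_r/m)·{0, r; m/r}` of single blocks with gates `m/r ≥ m/M ≥ x` and credit `m`; a structure of
mean `0` is the sure empty component.

* `Quant.RootDec.sum_range_eq_of_vanish` — bookkeeping: sums of a function vanishing above `M` over `{0..N} ⊇ {0..M}`.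
* `Quant.RootDec.rtail_ge_of_mean_le_one` — **structure laws `μ k ≥ 0` supported in `{0..M k}` with total mass `1` and means
  `m k ≤ 1`, a floor `x ≤ 1` with `x·M k ≤ m k`, and `2j < Σ_k m k` ⟹ `x ≤ RTAIL[M, μ, j]`.**  In words: FAR at the root for every
  forest of independent structures of ARBITRARY shape each of which carries at most one relay in expectation.  Gate coordinates
  (`Quant.FarTreeRow` instance-wise with the one extra hypothesis 'every tree of the forest has expected reached-relay count ≤ 1')
  follow in `…QuantFarTreeMeanLeOne.lean`.

[this work]; the gluing rows served [cite: KozmaNitzan2024, Conjecture 3 (p. 15)].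
-/

namespace Summit.CriticalPhenomena.PercolationContinuityZ3.Theorems

namespace Quant

namespace RootDec

open Finset

variable {κ : Type*} [Fintype κ] [DecidableEq κ]

/-- configurations of structure counts bounded by `M` (as in `…QuantRootReduction`) -/
local notation3 "cfg[" M "]" => Fintype.piFinset (fun k : κ => Finset.range ((M : κ → ℕ) k + 1))

/-- the ROOT tail (as in `…QuantRootReduction`) -/
local notation3 "RTAIL[" M ", " μ ", " j "]" =>
  ∑ c ∈ cfg[M], (∏ k, (μ : κ → ℕ → ℝ) k ((c : κ → ℕ) k)) * (if (j : ℕ) + 1 ≤ ∑ k, (c : κ → ℕ) k then (1 : ℝ) else 0)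

/-- the two-point law `{lo, hi; g}` (as in `…QuantRootReduction`) -/
local notation3 "TP[" lo ", " hi ", " g ", " h "]" =>
  (g : ℝ) * (if (h : ℕ) = (hi : ℕ) then (1 : ℝ) else 0) + (1 - (g : ℝ)) * (if (h : ℕ) = (lo : ℕ) then (1 : ℝ) else 0)

omit [Fintype κ] [DecidableEq κ] in
/-- A function vanishing above `M` has the same sum over `{0..N}` as over `{0..M}` (`M ≤ N`). [this work] -/
theorem sum_range_eq_of_vanish (f : ℕ → ℝ) (M N : ℕ) (hMN : M ≤ N) (hf : ∀ h, M < h → f h = 0) :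
    ∑ h ∈ Finset.range (N + 1), f h = ∑ h ∈ Finset.range (M + 1), f h := by
  symm
  refine Finset.sum_subset (Finset.range_subset_range.2 (by omega)) fun h hN hM => hf h ?_
  rw [Finset.mem_range] at hN hM
  omega

/-- **FAR at the root for forests of sub-unit-mean structures (unconditional).**  Structure laws `μ k ≥ 0` supported in
`{0, …, M k}` (`M k ≤ N`) with total mass `1` and means `m k = Σ_h h·μ k h ≤ 1`; a floor `x ≤ 1` with `x·M k ≤ m k` for every `k`
(automatic when each of the `M k` relays of structure `k` has marginal `≥ x`); budget `2j < Σ_k m k`.  Then `x ≤ RTAIL[M, μ, j]`.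
Proof: `rtail_ge_of_heavyDec` with the size-biased decomposition of every structure of positive mean (components `{0, r; m k/r}`,
weights `r·μ k r/m k`, credit `m k`, gates `m k/r ≥ m k/M k ≥ x`) and the sure empty component for structures of mean `0`. [this work] -/
theorem rtail_ge_of_mean_le_one (M : κ → ℕ) (N : ℕ) (hMN : ∀ k, M k ≤ N) (μ : κ → ℕ → ℝ)
    (hμ0 : ∀ k h, 0 ≤ μ k h) (hsupp : ∀ k h, M k < h → μ k h = 0)
    (hμ1 : ∀ k, ∑ h ∈ Finset.range (M k + 1), μ k h = 1)
    (m : κ → ℝ) (hm : ∀ k, m k = ∑ h ∈ Finset.range (M k + 1), (h : ℝ) * μ k h) (hm1 : ∀ k, m k ≤ 1)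
    (x : ℝ) (hx1 : x ≤ 1) (hfloor : ∀ k, x * (M k : ℝ) ≤ m k) (j : ℕ) (hbudget : (2 * j : ℝ) < ∑ k, m k) :
    x ≤ RTAIL[M, μ, j] := by
  -- means are non-negative; a zero mean forces the law `δ_0`
  have hm0 : ∀ k, 0 ≤ m k := fun k => by
    rw [hm k]; exact Finset.sum_nonneg fun h _ => mul_nonneg (Nat.cast_nonneg h) (hμ0 k h)
  have hzero : ∀ k, m k = 0 → ∀ h, h ≠ 0 → μ k h = 0 := by
    intro k hk h hh
    by_cases hhM : M k < h
    · exact hsupp k h hhM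
    · have hmem : h ∈ Finset.range (M k + 1) := Finset.mem_range.2 (by omega)
      have hterm : (h : ℝ) * μ k h = 0 :=
        (Finset.sum_eq_zero_iff_of_nonneg (fun h' _ => mul_nonneg (Nat.cast_nonneg h') (hμ0 k h'))).1
          ((hm k).symm.trans hk) h hmem
      rcases mul_eq_zero.1 hterm with h1 | h1
      · exact absurd (Nat.cast_eq_zero.1 h1) hh
      · exact h1
  have hzero0 : ∀ k, m k = 0 → μ k 0 = 1 := by
    intro k hk
    have h1 := hμ1 k
    rw [Finset.sum_range_succ', Finset.sum_eq_zero (fun i _ => hzero k hk (i + 1) (Nat.succ_ne_zero i)), zero_add] at h1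
    exact h1
  -- the same sums over `{0..N}`
  have hμ1N : ∀ k, ∑ h ∈ Finset.range (N + 1), μ k h = 1 := fun k => by
    rw [sum_range_eq_of_vanish (μ k) (M k) N (hMN k) (hsupp k), hμ1 k]
  have hmN : ∀ k, m k = ∑ h ∈ Finset.range (N + 1), (h : ℝ) * μ k h := fun k => by
    rw [sum_range_eq_of_vanish (fun h => (h : ℝ) * μ k h) (M k) N (hMN k) (fun h hh => by rw [hsupp k h hh, mul_zero]), hm k]
  have hsuppr : ∀ k (r : ℕ), μ k r ≠ 0 → r ≤ M k := fun k r hr => not_lt.1 fun h' => hr (hsupp k r h')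
  -- the decomposition data on `ρ = Fin (N+1)`
  set lam : κ → Fin (N + 1) → ℝ := fun k r =>
    if m k = 0 then (if (r : ℕ) = 0 then 1 else 0) else ((r : ℕ) : ℝ) * μ k r / m k with hlam
  set gt : κ → Fin (N + 1) → ℝ := fun k r => if (r : ℕ) = 0 then 1 else m k / (r : ℕ) with hgt
  -- what a genuine component looks like
  have hgen : ∀ k (r : Fin (N + 1)), 0 < lam k r →
      (m k = 0 ∧ (r : ℕ) = 0) ∨ (m k ≠ 0 ∧ (r : ℕ) ≠ 0 ∧ μ k r ≠ 0 ∧ (r : ℕ) ≤ M k) := by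
    intro k r hpos
    simp only [hlam] at hpos
    by_cases hk : m k = 0
    · left
      rw [if_pos hk] at hpos
      by_cases hr : (r : ℕ) = 0
      · exact ⟨hk, hr⟩
      · rw [if_neg hr] at hpos; exact absurd hpos (lt_irrefl 0)
    · right
      rw [if_neg hk] at hpos
      have hμr : μ k r ≠ 0 := fun h0 => by rw [h0, mul_zero, zero_div] at hpos; exact lt_irrefl 0 hpos
      have hr0 : (r : ℕ) ≠ 0 := fun h0 => by rw [h0, Nat.cast_zero, zero_mul, zero_div] at hpos; exact lt_irrefl 0 hpos
      exact ⟨hk, hr0, hμr, hsuppr k r hμr⟩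
  refine rtail_ge_of_heavyDec (ρ := Fin (N + 1)) M μ lam (fun _ _ => 0) (fun k r => min (r : ℕ) (M k)) gt m j x hx1
    ?_ ?_ ?_ (fun _ _ => Nat.zero_le _) (fun _ _ => Nat.min_le_right _ _) ?_ ?_ ?_ hbudget
  · -- weights are non-negative
    intro k r
    simp only [hlam]
    by_cases hk : m k = 0
    · rw [if_pos hk]; split_ifs <;> norm_num
    · rw [if_neg hk]; exact div_nonneg (mul_nonneg (Nat.cast_nonneg _) (hμ0 k r)) (hm0 k)
  · -- weights sum to one
    intro k
    simp only [hlam]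
    by_cases hk : m k = 0
    · simp only [if_pos hk]
      rw [Fin.sum_univ_eq_sum_range (fun i => if i = 0 then (1 : ℝ) else 0) (N + 1), Finset.sum_ite_eq',
        if_pos (Finset.mem_range.2 (Nat.succ_pos N))]
    · simp only [if_neg hk]
      exact sizeBiased_weights_sum (μ k) N (m k) (hmN k) hk
  · -- the law identity
    intro k h
    simp only [hlam, hgt]
    by_cases hk : m k = 0
    · simp only [if_pos hk]
      rw [Fin.sum_univ_eq_sum_range (fun i => (if i = 0 then (1 : ℝ) else 0) *
          ((if i = 0 then (1 : ℝ) else m k / i) * (if h = min i (M k) then (1 : ℝ) else 0) +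
            (1 - (if i = 0 then (1 : ℝ) else m k / i)) * (if h = 0 then (1 : ℝ) else 0))) (N + 1),
        Finset.sum_eq_single 0 (fun i _ hi => by rw [if_neg hi, zero_mul]) (fun h0 => absurd (Finset.mem_range.2 (Nat.succ_pos N)) h0)]
      rw [if_pos rfl, if_pos rfl, Nat.zero_min, one_mul, one_mul, sub_self, zero_mul, add_zero]
      by_cases hh : h = 0
      · rw [hh, if_pos rfl, hzero0 k hk]
      · rw [if_neg hh, hzero k hk h hh]
    · simp only [if_neg hk]
      by_cases hhN : h ≤ N
      · rw [twoPoint_sizeBiased (μ k) N (hμ1N k) (m k) (hmN k) hk h hhN]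
        refine Finset.sum_congr rfl fun r _ => ?_
        by_cases hr0 : (r : ℕ) = 0
        · rw [hr0, Nat.cast_zero, zero_mul, zero_div, zero_mul, zero_mul]
        · rw [if_neg hr0]
          by_cases hrM : (r : ℕ) ≤ M k
          · rw [min_eq_left hrM]
          · rw [hsupp k r (not_le.1 hrM), mul_zero, zero_div, zero_mul, zero_mul]
      · rw [hsupp k h (lt_of_le_of_lt (hMN k) (not_le.1 hhN))]
        symm
        refine Finset.sum_eq_zero fun r _ => ?_
        have h1 : ¬ (h = min (r : ℕ) (M k)) := fun e => hhN (e ▸ (min_le_right _ _).trans (hMN k))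
        have h2 : ¬ (h = 0) := fun e => hhN (e ▸ Nat.zero_le N)
        rw [if_neg h1, if_neg h2, mul_zero, mul_zero, add_zero, mul_zero]
  · -- genuine gates are probabilities
    intro k r hpos
    simp only [hgt]
    rcases hgen k r hpos with ⟨_, hr⟩ | ⟨hk, hr0, -, -⟩
    · rw [if_pos hr]; norm_num
    · rw [if_neg hr0]
      have hr1 : (1 : ℝ) ≤ (r : ℕ) := by exact_mod_cast Nat.one_le_iff_ne_zero.2 hr0
      exact ⟨div_nonneg (hm0 k) (by linarith), div_le_one_of_le₀ ((hm1 k).trans hr1) (by linarith)⟩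
  · -- genuine non-empty components are heavy
    intro k r hpos hlt
    simp only [hgt]
    rcases hgen k r hpos with ⟨_, hr⟩ | ⟨hk, hr0, -, hrM⟩
    · exfalso; rw [hr, Nat.zero_min] at hlt; exact lt_irrefl 0 hlt
    · rw [if_neg hr0]
      have hrpos : (0 : ℝ) < (r : ℕ) := by exact_mod_cast Nat.pos_of_ne_zero hr0
      rw [le_div_iff₀ hrpos]
      by_cases hx0 : 0 ≤ x
      · calc x * ((r : ℕ) : ℝ) ≤ x * (M k : ℝ) := mul_le_mul_of_nonneg_left (by exact_mod_cast hrM) hx0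
          _ ≤ m k := hfloor k
      · have : x * ((r : ℕ) : ℝ) ≤ 0 := mul_nonpos_of_nonpos_of_nonneg (not_le.1 hx0).le hrpos.le
        linarith [hm0 k]
  · -- credit of a genuine component is the mean
    intro k r hpos
    simp only [hgt]
    rcases hgen k r hpos with ⟨hk, hr⟩ | ⟨hk, hr0, -, hrM⟩
    · rw [hk, hr, Nat.zero_min, if_pos rfl]; norm_num
    · rw [if_neg hr0, min_eq_left hrM]
      exact (sizeBiased_credit (m k) r hr0).ge

end RootDec

end Quant

end Summit.CriticalPhenomena.PercolationContinuityZ3.Theorems
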